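import Mathlib
import HarnessLib
import Summits.HubbardSuperconductivity.HubbardSuperconductivity.Theorems.KLProgrammeKLRegimeSplitEdgeFactsComplMemberJets
import Summits.HubbardSuperconductivity.HubbardSuperconductivity.Theorems.KLProgrammeKLRegimeSplitEdgeFactsRungJetsTransportV
import Summits.HubbardSuperconductivity.HubbardSuperconductivity.Theorems.KLProgrammeKLRegimeSplitEdgeFactsBubblePin

/-!
# Route `KLProgramme` — edge facts for the pair masses ACROSS TRANSFERS, X′: the complementary members' (D2)-deep POINTWISE rows (row 25a `…ComplMemberJets`)
# with ABSTRACT band-jet constants `(v, κ)` — `klcdv_term1_pointwise`, `klcdv_term2_pointwise` and the transfer-weight support/region lemmas that carry the deep condition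

Cell gate-hubbard-kl, seat hubbard-kl-k3c1-p1 (g22; child-1 lineage); cure of the located «(s2)-JETS-COEFFNORM-KEYING».  Row 25a re-proved ONCE over the abstract jets
(section hypotheses `hjet`, `hjv : 4 ≤ v`, `hjκ : 4 ≤ κ`, each theorem taking exactly the ones it uses; see `…RungJetsV`, `…RungJetsTransportV`): the deep
condition reads `v·|p_Q|_𝕋 ≤ Λ_n/16`, the pointwise bounds carry `(κ + 2v²g)`-type constants.  Instantiable by row 20 (`v = 4 + coeffNorm 1 K`) and by row 20′
`…BandJetsSup` (`v = 4 + 2A_K`, `κ = 4 + 8A_K`, regime-native).  Statements and proofs are row 25a's verbatim with the substitution; the jet-free support lemmas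
(`klcd_sq_le_of_cutoffWeight_ne_zero`, `klcd_cutoffWeight_eq_one_of_sq_le`, `klcd_klScale_le_quarter`, `klcd_sq_lt_of_soft_ne_zero`, `klcd_soft_eq_one_sub`,
`klcd_soft_even`) are imported, not restated.  Everything is proved; no definitions; nothing asserts any slot, stub, K3 or SC. [folklore]
-/

noncomputable section

namespace Summit.HubbardSuperconductivity.HubbardSuperconductivity.Theorems.KLRegimeSplit

set_option linter.dupNamespace false -- summit = problem name (single-conjunct summit), D-0017

open Real Finset Literature.MathematicalPhysics.QuantumLattice Literature.Probability.LatticeModels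
open Literature.MathematicalPhysics.QuantumLattice.FermiRG
open Summit.HubbardSuperconductivity.HubbardSuperconductivity.Theorems.KLProgrammeLegKernels
open Summit.HubbardSuperconductivity.HubbardSuperconductivity.Theorems.TwoPointAssembly

section ComplDeep

variable {L M : ℕ} [NeZero L] (β μ : ℝ) (K : TrigPolyC4v)
variable {v κ : ℝ}
  (hjet : (∀ k Q : TorusSite 2 L, |nambuXiCT L μ K (k + Q) - nambuXiCT L μ K k| ≤ v * klTorusNorm L Q) ∧
    (∀ k Q : TorusSite 2 L, |nambuXiCT L μ K (k - Q) - nambuXiCT L μ K k| ≤ v * klTorusNorm L Q) ∧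
      ∀ k Q : TorusSite 2 L, |nambuXiCT L μ K (k + Q) - 2 * nambuXiCT L μ K k + nambuXiCT L μ K (k - Q)| ≤ κ * klTorusNorm L Q ^ 2)
  (hjv : 4 ≤ v) (hjκ : 4 ≤ κ)
include hjet hjv hjκ

/-! ## §1 Support facts of the two weights and of the complementary member -/

omit hjκ in
/-- **Support of the transfer weight of a complementary member**: `n + 1 ≤ m`, `Λ_n + v·|p_Q|_𝕋 ≤ |e_K(p)|` ⟹ `t_n[s_{n,m}](Q,p) = 0`
(the member vanishes at `p` and, the band moving by at most `v|p_Q|_𝕋`, at `Q − p`). [folklore] -/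
theorem klcdv_transferWeight_eq_zero_of_far [NeZero M] {n m : ℕ} (hnm : n + 1 ≤ m) (Q p : TorusSite 2 L)
    (hfar : klScale klE0 n + v * klTorusNorm L Q ≤ |nambuXiCT L μ K p|) :
    klTransferWeight L M β μ K n (softSymbolCompl L M β μ K n m) Q p = 0 := by
  have hvs : 0 ≤ v * klTorusNorm L Q :=
    mul_nonneg (by linarith) (EngineV8.klband_klTorusNorm_nonneg (L := L) Q)
  have h1 : ∀ ν : MatsubaraIdx M, softSymbolCompl L M β μ K n m (ν, p) = 0 := fun ν => by
    by_contra h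
    have h' := (klcd_sq_lt_of_soft_ne_zero β μ K hnm (ν, p) h).2
    simp only at h'
    linarith
  have h2 : ∀ ν : MatsubaraIdx M, softSymbolCompl L M β μ K n m (ν, Q - p) = 0 := fun ν => by
    by_contra h
    have h' := (klcd_sq_lt_of_soft_ne_zero β μ K hnm (ν, Q - p) h).2
    simp only at h'
    have he : nambuXiCT L μ K (Q - p) = nambuXiCT L μ K (p - Q) := by rw [← neg_sub, nambuXiCT_neg L μ K]
    rw [he] at h'
    have hd := hjet.2.1 p Q
    have ht := abs_sub_abs_le_abs_sub (nambuXiCT L μ K p) (nambuXiCT L μ K (p - Q))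
    rw [abs_sub_comm] at ht
    linarith
  unfold klTransferWeight
  simp [h1, h2]

omit hjκ in
/-- **The ball restriction is inactive**: for any `B ⊇ {p : |e_K(p)| < Λ_n + v|p_Q|_𝕋}`,
`Σ_{p ∈ B} t_n[s_{n,m}](Q,p) = Σ_p t_n[s_{n,m}](Q,p)` (`n + 1 ≤ m`). [folklore] -/
theorem klcdv_sum_transferWeight_subset_eq [NeZero M] {n m : ℕ} (hnm : n + 1 ≤ m) (Q : TorusSite 2 L) (B : Finset (TorusSite 2 L))
    (hB : ∀ p : TorusSite 2 L, |nambuXiCT L μ K p| < klScale klE0 n + v * klTorusNorm L Q → p ∈ B) :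
    ∑ p ∈ B, klTransferWeight L M β μ K n (softSymbolCompl L M β μ K n m) Q p = ∑ p, klTransferWeight L M β μ K n (softSymbolCompl L M β μ K n m) Q p :=
  Finset.sum_subset (Finset.subset_univ B) fun p _ hp =>
    klcdv_transferWeight_eq_zero_of_far β μ K hjet hjv hnm Q p (not_lt.1 fun h => hp (hB p h))

/-! ## §2 Term 1: the three-point region of the member seen from a hard centre -/

omit [NeZero L] in
/-- **Term 1, pointwise** (`0 < β`, `n + 1 ≤ m`, deep step `v·|p_Q|_𝕋 ≤ Λ_n/16`): at a frequency–momentum with `w_{Λ_n}(ν,p) ≠ 0` and the member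
nonzero at one of `p, p ± Q`, with `Λ = Λ_n`, `A = Λ/2`, `g = 2/A`, `E = (Λ + Λ/16) + A/2`, `v = v`, `κ = κ`, `s = |p_Q|_𝕋`:
`‖δ²_Q(s_{n,m}·ĝ_K)(ν,p)‖ ≤ Φ₂·g + 2·Φ₁·(v·s)·g² + 1·((κ + 2v²g)·g²·s²)`, `Φ₁ = (8/3)(v·s·2E/Λ²)`, `Φ₂ = ((16/3)(Eκ + v²)/Λ² + (1408/9)E²v²/Λ⁴)·s²`. [folklore] -/
theorem klcdv_term1_pointwise [NeZero M] (hβ : 0 < β) {n m : ℕ} (hnm : n + 1 ≤ m) (Q : TorusSite 2 L)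
    (hdeep : v * klTorusNorm L Q ≤ klScale klE0 n / 16) (ν : MatsubaraIdx M) (p : TorusSite 2 L)
    (hw : hubbardCutoffWeightCT L M β μ K (klScale klE0 n) (ν, p) ≠ 0)
    (hφ3 : softSymbolCompl L M β μ K n m (ν, p + Q) ≠ 0 ∨ softSymbolCompl L M β μ K n m (ν, p) ≠ 0 ∨ softSymbolCompl L M β μ K n m (ν, p - Q) ≠ 0) :
    ‖(softSymbolCompl L M β μ K n m (ν, p + Q) : ℂ) * propCT L M β μ K (ν, p + Q) -
          2 * ((softSymbolCompl L M β μ K n m (ν, p) : ℂ) * propCT L M β μ K (ν, p)) +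
        (softSymbolCompl L M β μ K n m (ν, p - Q) : ℂ) * propCT L M β μ K (ν, p - Q)‖ ≤
      (16 / 3 * (((klScale klE0 n + klScale klE0 n / 16) + klScale klE0 n / 2 / 2) * κ + v ^ 2) / klScale klE0 n ^ 2 +
              1408 / 9 * ((klScale klE0 n + klScale klE0 n / 16) + klScale klE0 n / 2 / 2) ^ 2 * v ^ 2 / klScale klE0 n ^ 4) *
            klTorusNorm L Q ^ 2 * (2 / (klScale klE0 n / 2)) +
          2 * (8 / 3 * (v * klTorusNorm L Q * (2 * (((klScale klE0 n + klScale klE0 n / 16) + klScale klE0 n / 2 / 2))) /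
              klScale klE0 n ^ 2) * (v * klTorusNorm L Q * (2 / (klScale klE0 n / 2)) ^ 2)) +
        1 * ((κ + 2 * v ^ 2 * (2 / (klScale klE0 n / 2))) * (2 / (klScale klE0 n / 2)) ^ 2 * klTorusNorm L Q ^ 2) := by
  set Λ := klScale klE0 n with hΛdef
  have hΛ : 0 < Λ := klth_klScale_pos n
  have hA : 0 < Λ / 2 := by positivity
  have hv : 0 ≤ v := by linarith
  have hs : 0 ≤ klTorusNorm L Q := EngineV8.klband_klTorusNorm_nonneg (L := L) Q
  have hvs : v * klTorusNorm L Q ≤ Λ / 2 / 2 := hdeep.trans (by linarith)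
  -- centre shell fact
  have hA2 : (Λ / 2) ^ 2 ≤ matsubaraFreq β M ν ^ 2 + nambuXiCT L μ K p ^ 2 := klcd_sq_le_of_cutoffWeight_ne_zero β μ K hΛ (ν, p) hw
  -- centre band size from the member's support at one of the three points
  have hdp := hjet.1 p Q
  have hdm := hjet.2.1 p Q
  have hEc : |nambuXiCT L μ K p| ≤ Λ + Λ / 16 := by
    rcases hφ3 with h | h | h
    · have h1 := (klcd_sq_lt_of_soft_ne_zero β μ K hnm (ν, p + Q) h).2
      have h2 := abs_sub_abs_le_abs_sub (nambuXiCT L μ K p) (nambuXiCT L μ K (p + Q))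
      rw [abs_sub_comm] at h2
      simp only at h1
      linarith
    · have h1 := (klcd_sq_lt_of_soft_ne_zero β μ K hnm (ν, p) h).2
      simp only at h1
      linarith
    · have h1 := (klcd_sq_lt_of_soft_ne_zero β μ K hnm (ν, p - Q) h).2
      have h2 := abs_sub_abs_le_abs_sub (nambuXiCT L μ K p) (nambuXiCT L μ K (p - Q))
      rw [abs_sub_comm] at h2
      simp only at h1
      linarith
  -- transported sizes
  obtain ⟨gp, g0, gm⟩ := klrtv_norm_propCT_three_le β μ K hjet hA ν p Q hA2 hvs
  obtain ⟨ep, e0, em⟩ := klrtv_abs_nambuXiCT_three_le μ K hjet hA.le p Q hEc hvs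
  -- flatness of the lower weight at the three points
  have hqp : (Λ / 2 / 2) ^ 2 ≤ matsubaraFreq β M ν ^ 2 + nambuXiCT L μ K (p + Q) ^ 2 := klrt_quarter_sq_le hA.le hA2 (hdp.trans hvs)
  have hqm : (Λ / 2 / 2) ^ 2 ≤ matsubaraFreq β M ν ^ 2 + nambuXiCT L μ K (p - Q) ^ 2 := klrt_quarter_sq_le hA.le hA2 (hdm.trans hvs)
  have hq0 : (Λ / 2 / 2) ^ 2 ≤ matsubaraFreq β M ν ^ 2 + nambuXiCT L μ K p ^ 2 := hA2.trans' (by nlinarith)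
  have e44 : Λ / 2 / 2 = Λ / 4 := by ring
  rw [e44] at hqp hqm hq0
  have fp := klcd_soft_eq_one_sub β μ K hnm (ν, p + Q) hqp
  have f0 := klcd_soft_eq_one_sub β μ K hnm (ν, p) hq0
  have fm := klcd_soft_eq_one_sub β μ K hnm (ν, p - Q) hqm
  -- profile sizes
  have h0 : |softSymbolCompl L M β μ K n m (ν, p - Q)| ≤ 1 := klrj_abs_softSymbolCompl_le_one β μ K n m (ν, p - Q)
  have h1 : |softSymbolCompl L M β μ K n m (ν, p) - softSymbolCompl L M β μ K n m (ν, p - Q)| ≤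
      8 / 3 * (v * klTorusNorm L Q * (2 * ((Λ + Λ / 16) + Λ / 2 / 2)) / Λ ^ 2) := by
    rw [f0, fm, show (1 - hubbardCutoffWeightCT L M β μ K Λ (ν, p)) - (1 - hubbardCutoffWeightCT L M β μ K Λ (ν, p - Q)) =
      -(hubbardCutoffWeightCT L M β μ K Λ (ν, p) - hubbardCutoffWeightCT L M β μ K Λ (ν, p - Q)) by ring, abs_neg]
    exact klrjv_abs_cutoffWeight_sub_le' β μ K hjet Λ ν p Q e0 em
  have h2 : |softSymbolCompl L M β μ K n m (ν, p + Q) - 2 * softSymbolCompl L M β μ K n m (ν, p) + softSymbolCompl L M β μ K n m (ν, p - Q)| ≤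
      (16 / 3 * (((Λ + Λ / 16) + Λ / 2 / 2) * κ + v ^ 2) / Λ ^ 2 +
          1408 / 9 * ((Λ + Λ / 16) + Λ / 2 / 2) ^ 2 * v ^ 2 / Λ ^ 4) * klTorusNorm L Q ^ 2 := by
    rw [fp, f0, fm, show (1 - hubbardCutoffWeightCT L M β μ K Λ (ν, p + Q)) - 2 * (1 - hubbardCutoffWeightCT L M β μ K Λ (ν, p)) +
        (1 - hubbardCutoffWeightCT L M β μ K Λ (ν, p - Q)) =
      -(hubbardCutoffWeightCT L M β μ K Λ (ν, p + Q) - 2 * hubbardCutoffWeightCT L M β μ K Λ (ν, p) + hubbardCutoffWeightCT L M β μ K Λ (ν, p - Q)) by ring,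
      abs_neg]
    exact klrjv_abs_cutoffWeight_secondDiff_le β μ K hjet hjv Λ ν p Q ep e0 em
  exact klrjv_norm_weightedRung_secondDiff_le β μ K hjet hjv hjκ hβ.ne' (softSymbolCompl L M β μ K n m) ν p Q gp g0 gm h0 h1 h2

/-! ## §3 Term 2: the member's support seen from a hard three-point region -/

omit [NeZero L] in
/-- **Term 2, pointwise** (`0 < β`, `n + 1 ≤ m`, deep step): at a frequency–momentum with `s_{n,m}(ν,p) ≠ 0` and `w_{Λ_n}` nonzero at one of `p, p ± Q`, with `Λ = Λ_n`,
`A′ = Λ/4`: the soft line `|s_{n,m}(ν,p)|·‖ĝ_K(ν,p)‖ ≤ 1/A′` and `‖δ²_Q(w_{Λ_n}·ĝ_K)(ν,p)‖ ≤ C(Λ + A′/2, Λ, 2/A′)·|p_Q|_𝕋²` (row 21 §4's closed form). [folklore] -/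
theorem klcdv_term2_pointwise [NeZero M] (hβ : 0 < β) {n m : ℕ} (hnm : n + 1 ≤ m) (Q : TorusSite 2 L)
    (hdeep : v * klTorusNorm L Q ≤ klScale klE0 n / 16) (ν : MatsubaraIdx M) (p : TorusSite 2 L)
    (hφ : softSymbolCompl L M β μ K n m (ν, p) ≠ 0)
    (hw3 : hubbardCutoffWeightCT L M β μ K (klScale klE0 n) (ν, p + Q) ≠ 0 ∨ hubbardCutoffWeightCT L M β μ K (klScale klE0 n) (ν, p) ≠ 0 ∨
      hubbardCutoffWeightCT L M β μ K (klScale klE0 n) (ν, p - Q) ≠ 0) :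
    |softSymbolCompl L M β μ K n m (ν, p)| * ‖propCT L M β μ K (ν, p)‖ ≤ 1 / (klScale klE0 n / 4) ∧
      ‖(hubbardCutoffWeightCT L M β μ K (klScale klE0 n) (ν, p + Q) : ℂ) * propCT L M β μ K (ν, p + Q) -
            2 * ((hubbardCutoffWeightCT L M β μ K (klScale klE0 n) (ν, p) : ℂ) * propCT L M β μ K (ν, p)) +
          (hubbardCutoffWeightCT L M β μ K (klScale klE0 n) (ν, p - Q) : ℂ) * propCT L M β μ K (ν, p - Q)‖ ≤
        ((16 / 3 * ((klScale klE0 n + klScale klE0 n / 4 / 2) * κ + v ^ 2) / klScale klE0 n ^ 2 +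
                1408 / 9 * (klScale klE0 n + klScale klE0 n / 4 / 2) ^ 2 * v ^ 2 / klScale klE0 n ^ 4) * (2 / (klScale klE0 n / 4)) +
              2 * (8 / 3 * (v * (2 * (klScale klE0 n + klScale klE0 n / 4 / 2)) / klScale klE0 n ^ 2)) * v *
                (2 / (klScale klE0 n / 4)) ^ 2 +
            (κ + 2 * v ^ 2 * (2 / (klScale klE0 n / 4))) * (2 / (klScale klE0 n / 4)) ^ 2) *
          klTorusNorm L Q ^ 2 := by
  set Λ := klScale klE0 n with hΛdef
  have hΛ : 0 < Λ := klth_klScale_pos n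
  have hA : 0 < Λ / 4 := by positivity
  have hvs2 : v * klTorusNorm L Q ≤ Λ / 2 / 2 := hdeep.trans (by linarith)
  have hvs : v * klTorusNorm L Q ≤ Λ / 4 / 2 := hdeep.trans (by linarith)
  have hdp := hjet.1 p Q
  have hdm := hjet.2.1 p Q
  -- centre band size and centre shell fact (quarter lemma from the hard point)
  obtain ⟨-, hE⟩ := klcd_sq_lt_of_soft_ne_zero β μ K hnm (ν, p) hφ
  simp only at hE
  have hA2 : (Λ / 4) ^ 2 ≤ matsubaraFreq β M ν ^ 2 + nambuXiCT L μ K p ^ 2 := by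
    have e24 : Λ / 2 / 2 = Λ / 4 := by ring
    rcases hw3 with h | h | h
    · have h1 := klcd_sq_le_of_cutoffWeight_ne_zero β μ K hΛ (ν, p + Q) h
      have h2 : |nambuXiCT L μ K p - nambuXiCT L μ K (p + Q)| ≤ Λ / 2 / 2 := by rw [abs_sub_comm]; exact hdp.trans hvs2
      rw [← e24]; exact klrt_quarter_sq_le (by positivity) h1 h2
    · exact (klcd_sq_le_of_cutoffWeight_ne_zero β μ K hΛ (ν, p) h).trans' (by nlinarith)
    · have h1 := klcd_sq_le_of_cutoffWeight_ne_zero β μ K hΛ (ν, p - Q) h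
      have h2 : |nambuXiCT L μ K p - nambuXiCT L μ K (p - Q)| ≤ Λ / 2 / 2 := by rw [abs_sub_comm]; exact hdm.trans hvs2
      rw [← e24]; exact klrt_quarter_sq_le (by positivity) h1 h2
  obtain ⟨gp, g0, gm⟩ := klrtv_norm_propCT_three_le β μ K hjet hA ν p Q hA2 hvs
  obtain ⟨ep, e0, em⟩ := klrtv_abs_nambuXiCT_three_le μ K hjet hA.le p Q hE.le hvs
  refine ⟨?_, klrjv_norm_cutoffWeightedRung_secondDiff_le β μ K hjet hjv hjκ hβ.ne' Λ ν p Q gp g0 gm ep e0 em⟩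
  have hg := klrt_norm_propCT_le_one_div β μ K hA (ν, p) hA2
  have h1 := klrj_abs_softSymbolCompl_le_one β μ K n m (ν, p)
  calc |softSymbolCompl L M β μ K n m (ν, p)| * ‖propCT L M β μ K (ν, p)‖ ≤ 1 * (1 / (Λ / 4)) := mul_le_mul h1 hg (norm_nonneg _) zero_le_one
    _ = 1 / (Λ / 4) := one_mul _

end ComplDeep

end Summit.HubbardSuperconductivity.HubbardSuperconductivity.Theorems.KLRegimeSplit

end

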